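import Summits.AtomisticToContinuum.Crystallization.Theorems.SquareWellLayerCakeGapTwelveToBarlowCombinatorialLayeringTransportSteps1
import Summits.AtomisticToContinuum.Crystallization.Theorems.SquareWellLayerCakeGapTwelveToBarlowCombinatorialLayeringTransportSteps2
import Summits.AtomisticToContinuum.Crystallization.Theorems.SquareWellLayerCakeGapTwelveToBarlowCombinatorialLayeringTransportSteps3
import Summits.AtomisticToContinuum.Crystallization.Theorems.SquareWellLayerCakeGapTwelveToBarlowCombinatorialLayeringTransportSteps4
import Summits.AtomisticToContinuum.Crystallization.Theorems.SquareWellLayerCakeGapTwelveToBarlowCombinatorialLayeringTransportSteps5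
import Summits.AtomisticToContinuum.Crystallization.Theorems.SquareWellLayerCakeGapTwelveToBarlowCombinatorialLayeringTransportSteps6

/-!
# Combinatorial layering (B1a of `GapTwelveToBarlow`): transport port, part `Steps7`

Crux `SquareWellLayerCake.GapTwelveToBarlow` (stmt-AtomisticToContinuum-15807), line `Sketch`,
stub `stub_combinatorialLayering`, residual `(H_develop)`.  PORT of the tree file
`PalmUnimodularRigidityShellsToBarlowChartTransportSteps7.lean` (crux 9227) to GRADED COMBINATORIAL
charts, following the port rules recorded in `…CombinatorialLayeringTransportSteps1` (bundled
standing hypothesis `hch` on `S : ℕ → Set E3`, abstract bond relation `B`, memberships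
`x ∈ S (n + k)`, transfer as an input).  Statements and proofs are otherwise those of the source,
whose documentation follows.

# Line `develop-the-model-growth-descent` (crux `ShellsToBarlowChart`, stmt-AtomisticToContinuum-9227): the four in-layer transports `I, J, I⁻¹, J⁻¹` and the vertical transport `V` of frames read in integer charts (specifications, inverse identities, apexes) (part 7/7)

Helper lemmas for `stub_transportSystem` (the geometric half of the line): frames `⟨x, t₁, t₂, U⟩`
read in the integer charts `IsZChart` of a good-shell configuration, their transports and the
coherence of the resulting development `frameAt`.  The only metric inputs are the chart transfer
lemma and `bond_nb_iff`; everything else is label combinatorics in `ℤ³` (pattern facts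
`TransportPatterns*`).  All `[folklore]` (HalesDSP2012 §1.3 for the two kissing patterns).
-/

noncomputable section

namespace Summit.AtomisticToContinuum.Crystallization.Theorems.SquareWellLayerCakeGapTwelveToBarlow

open Literature.Geometry.DiscreteGeometry Literature.MathematicalPhysics.StatisticalMechanics
open Summit.AtomisticToContinuum.Crystallization.Theorems.PalmUnimodularRigidityShellsToBarlowChart hiding
  IsZChart TransportSystem scales_tied sqNormInt_transfer bond_symm nb_mem zlab_spec zlab_nb
  bond_nb_iff pattern_cases transfer_nb_nb transfer_nb_centre transfer_nb_target
  sqNormInt_zlab_centre hcp_of_mirror_pair Istep_spec Jstep_spec IinvStep_spec JinvStep_spec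
  capWithAny_of_mem_cap IinvStep_Istep Istep_IinvStep JinvStep_Jstep Jstep_JinvStep polar_at_apex
  onesided_at_apex Vstep_spec nb_inj Istep_lower Jstep_lower IinvStep_lower JinvStep_lower
  polar_at_lower_apex onesided_at_lower_apex VinvStep_spec attach_I_even attach_I_odd
  attach_lower_I_pos attach_lower_I_neg attach_J_even attach_J_odd Vstep_Istep_pt Vstep_Istep_back
  Vstep_Istep_side Vstep_Jstep_pt Vstep_Istep_comm Vstep_Jstep_comm attach_lower_J_pos
  attach_lower_J_neg VinvStep_Istep_pt VinvStep_Jstep_pt VinvStep_Istep_back VinvStep_Istep_side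
  VinvStep_Istep_comm VinvStep_Jstep_comm Istep_Jstep_comm

variable {S : ℕ → Set (EuclideanSpace ℝ (Fin 3))}
  {B : EuclideanSpace ℝ (Fin 3) → EuclideanSpace ℝ (Fin 3) → Prop}
  {Pc : EuclideanSpace ℝ (Fin 3) → Finset (Fin 3 → ℤ)}
  {nb : EuclideanSpace ℝ (Fin 3) → (Fin 3 → ℤ) → EuclideanSpace ℝ (Fin 3)}

variable
  (hch : (∀ n : ℕ, ∀ z ∈ S n, (Pc z = fcc3Int ∨ Pc z = hcpInt) ∧
      Set.BijOn (nb z) (↑(Pc z) : Set (Fin 3 → ℤ)) {y | B z y} ∧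
      ∀ t ∈ Pc z, ∀ t' ∈ Pc z, (B (nb z t) (nb z t') ↔ sqNormInt (t - t') = 18)) ∧
    (∀ n : ℕ, ∀ z ∈ S (n + 1), ∀ y, B z y → y ∈ S n) ∧
    (∀ n m : ℕ, ∀ x ∈ S n, ∀ y ∈ S m, B x y →
      ∀ (z z' : EuclideanSpace ℝ (Fin 3)) (t t' u u' : Fin 3 → ℤ),
        (t = 0 ∧ z = x ∨ t ∈ Pc x ∧ z = nb x t) → (t' = 0 ∧ z' = x ∨ t' ∈ Pc x ∧ z' = nb x t') →
        (u = 0 ∧ z = y ∨ u ∈ Pc y ∧ z = nb y u) → (u' = 0 ∧ z' = y ∨ u' ∈ Pc y ∧ z' = nb y u') →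
        sqNormInt (u - u') = sqNormInt (t - t')) ∧
    (∀ x y, B x y → B y x))

include hch


/-- **The V-step.**  For a valid frame `g = ⟨x, t₁, t₂, U⟩` whose four in-layer transports are
valid frames, `Vstep g` lands at the apex site `u = nb x c` (`c = apexOf t₁ t₂ U ∈ U`), is a
valid frame, its lower cap is `{ξ, ξ ± t₁ᵘ, ξ ± t₂ᵘ}` (`ξ` = label of `x` at `u`, sign = parity
of `g`) read as the letter `frameParity t₁ t₂ U`, with apex `ξ`; and the lower-cap labels
label `x` and its two in-layer neighbours through which the directions were transported.
[folklore] -/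
theorem Vstep_spec {n : ℕ} {x : (EuclideanSpace ℝ (Fin 3))} (hx : x ∈ S (n + 3)) {t₁ t₂ : Fin 3 → ℤ} {U : Finset (Fin 3 → ℤ)} (hU : IsFrame (Pc x) t₁ t₂ U) (hI : IsFrame (Pc (nb x t₁)) (Istep Pc nb ⟨x, t₁, t₂, U⟩).t₁ (Istep Pc nb ⟨x, t₁, t₂, U⟩).t₂ (Istep Pc nb ⟨x, t₁, t₂, U⟩).U) (hJ : IsFrame (Pc (nb x t₂)) (Jstep Pc nb ⟨x, t₁, t₂, U⟩).t₁ (Jstep Pc nb ⟨x, t₁, t₂, U⟩).t₂ (Jstep Pc nb ⟨x, t₁, t₂, U⟩).U) (hIi : IsFrame (Pc (nb x (-t₁))) (IinvStep Pc nb ⟨x, t₁, t₂, U⟩).t₁ (IinvStep Pc nb ⟨x, t₁, t₂, U⟩).t₂ (IinvStep Pc nb ⟨x, t₁, t₂, U⟩).U) (hJi : IsFrame (Pc (nb x (-t₂))) (JinvStep Pc nb ⟨x, t₁, t₂, U⟩).t₁ (JinvStep Pc nb ⟨x, t₁, t₂, U⟩).t₂ (JinvStep Pc nb ⟨x, t₁,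 t₂, U⟩).U) : apexOf t₁ t₂ U ∈ U ∧ nb x (apexOf t₁ t₂ U) ∈ S (n + 2) ∧ (B x (nb x (apexOf t₁ t₂ U))) ∧ zlab Pc nb (nb x (apexOf t₁ t₂ U)) x ∈ Pc (nb x (apexOf t₁ t₂ U)) ∧ nb (nb x (apexOf t₁ t₂ U)) (zlab Pc nb (nb x (apexOf t₁ t₂ U)) x) = x ∧ IsFrame (Pc (nb x (apexOf t₁ t₂ U))) (Vstep Pc nb ⟨x, t₁, t₂, U⟩).t₁ (Vstep Pc nb ⟨x, t₁, t₂, U⟩).t₂ (Vstep Pc nb ⟨x, t₁, t₂, U⟩).U ∧ lowerParity (Vstep Pc nb ⟨x, t₁, t₂, U⟩).t₁ (Vstep Pc nb ⟨x, t₁, t₂, U⟩).t₂ (lowerCap (Pc (nb x (apexOf t₁ t₂ U))) (Vstep Pc nb ⟨x, t₁, t₂, U⟩).t₁ (Vstep Pc nb ⟨x, t₁, t₂, U⟩).t₂ (Vstep Pc nb ⟨x, t₁, t₂, U⟩).U) = frameParity t₁ t₂ U ∧ ((frameParity t₁ t₂ U = 1 ∧ lowerCap (Pc (nb x (apexOf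 t₁ t₂ U))) (Vstep Pc nb ⟨x, t₁, t₂, U⟩).t₁ (Vstep Pc nb ⟨x, t₁, t₂, U⟩).t₂ (Vstep Pc nb ⟨x, t₁, t₂, U⟩).U = {zlab Pc nb (nb x (apexOf t₁ t₂ U)) x, zlab Pc nb (nb x (apexOf t₁ t₂ U)) x + (Vstep Pc nb ⟨x, t₁, t₂, U⟩).t₁, zlab Pc nb (nb x (apexOf t₁ t₂ U)) x + (Vstep Pc nb ⟨x, t₁, t₂, U⟩).t₂} ∧ nb (nb x (apexOf t₁ t₂ U)) (zlab Pc nb (nb x (apexOf t₁ t₂ U)) x + (Vstep Pc nb ⟨x, t₁, t₂, U⟩).t₁) = nb x t₁ ∧ nb (nb x (apexOf t₁ t₂ U)) (zlab Pc nb (nb x (apexOf t₁ t₂ U)) x + (Vstep Pc nb ⟨x, t₁, t₂, U⟩).t₂) = nb x t₂ ∧ U = {apexOf t₁ t₂ U, apexOf t₁ t₂ U - t₁, apexOf t₁ t₂ U - t₂}) ∨ (frameParity t₁ t₂ U = -1 ∧ lowerCap (Pc (nb x (apexOf t₁ t₂ U))) (Vstep Pc nb ⟨x, t₁, t₂, U⟩).t₁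 (Vstep Pc nb ⟨x, t₁, t₂, U⟩).t₂ (Vstep Pc nb ⟨x, t₁, t₂, U⟩).U = {zlab Pc nb (nb x (apexOf t₁ t₂ U)) x, zlab Pc nb (nb x (apexOf t₁ t₂ U)) x - (Vstep Pc nb ⟨x, t₁, t₂, U⟩).t₁, zlab Pc nb (nb x (apexOf t₁ t₂ U)) x - (Vstep Pc nb ⟨x, t₁, t₂, U⟩).t₂} ∧ nb (nb x (apexOf t₁ t₂ U)) (zlab Pc nb (nb x (apexOf t₁ t₂ U)) x - (Vstep Pc nb ⟨x, t₁, t₂, U⟩).t₁) = nb x (-t₁) ∧ nb (nb x (apexOf t₁ t₂ U)) (zlab Pc nb (nb x (apexOf t₁ t₂ U)) x - (Vstep Pc nb ⟨x, t₁, t₂, U⟩).t₂) = nb x (-t₂) ∧ U = {apexOf t₁ t₂ U, apexOf t₁ t₂ U + t₁, apexOf t₁ t₂ U + t₂})) := by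
  obtain ⟨h12, hhex, hUP, hoff, c, hcU, hform⟩ := id hU
  have hPx := pattern_cases hch hx
  have ht₁ : t₁ ∈ Pc x := hhex (mem_hexLabels_iff.2 (Or.inl rfl))
  have ht₂ : t₂ ∈ Pc x := hhex (mem_hexLabels_iff.2 (Or.inr (Or.inl rfl)))
  have hnt₁ : -t₁ ∈ Pc x := hhex (mem_hexLabels_iff.2 (Or.inr (Or.inr (Or.inr (Or.inl rfl)))))
  have hnt₂ : -t₂ ∈ Pc x := hhex (mem_hexLabels_iff.2 (Or.inr (Or.inr (Or.inr (Or.inr (Or.inl rfl))))))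
  have hcP : c ∈ Pc x := hUP hcU
  have hc : c ∉ hexLabels t₁ t₂ := hoff c hcU
  have hapex : apexOf t₁ t₂ U = c := apexOf_eq_of_form hPx hU hcU hform
  rw [hapex]
  have hu := nb_mem hch hx hcP
  have hPu := pattern_cases hch hu.1
  have hξ := zlab_spec hch hu.1 hx (bond_symm hch hu.2)
  set ξ := zlab Pc nb (nb x c) x with hξ_def
  rcases hform with hE | hO
  · /- EVEN: lower sites of `u` are `x, Ix, Jx` -/
    have hc1 : c - t₁ ∈ Pc x := hUP (by rw [hE]; simp)
    have hc2 : c - t₂ ∈ Pc x := hUP (by rw [hE]; simp)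
    have hdx := dist_evenCap (Pc x) hPx t₁ ht₁ t₂ ht₂ c hcP h12 hhex hc hc1 hc2
    have hpar : frameParity t₁ t₂ U = 1 := by
      rw [hE]; exact (isFrame_evenCap (Pc x) hPx t₁ ht₁ t₂ ht₂ c hcP h12 hhex hc hc1 hc2).2
    -- `Ix, Jx` are neighbours of `u`
    have hbI : B (nb x c) (nb x t₁) :=
      (bond_nb_iff hch hx hcP ht₁).2 (by rw [sqNormInt_sub_comm]; exact hdx.2.1)
    have hbJ : B (nb x c) (nb x t₂) :=
      (bond_nb_iff hch hx hcP ht₂).2 (by rw [sqNormInt_sub_comm]; exact hdx.1)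
    have hη := zlab_spec hch hu.1 (nb_mem hch hx ht₁).1 hbI
    have hζ := zlab_spec hch hu.1 (nb_mem hch hx ht₂).1 hbJ
    set η := zlab Pc nb (nb x c) (nb x t₁) with hη_def
    set ζ := zlab Pc nb (nb x c) (nb x t₂) with hζ_def
    have Dηξ : sqNormInt (η - ξ) = 18 := by
      rw [hη_def, hξ_def, transfer_nb_centre hch hx hu.1 hu.2 ht₁ hbI]
      exact chart_sqNormInt_eq hch hx ht₁
    have Dζξ : sqNormInt (ζ - ξ) = 18 := by
      rw [hζ_def, hξ_def, transfer_nb_centre hch hx hu.1 hu.2 ht₂ hbJ]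
      exact chart_sqNormInt_eq hch hx ht₂
    have Dηζ : sqNormInt (η - ζ) = 18 := by
      rw [hη_def, hζ_def, transfer_nb_nb hch hx hu.1 hu.2 ht₁ ht₂ hbI hbJ]; exact h12
    -- one-sidedness at `u`: `u` is attached to `Ix` and `Jx` through their own upper caps
    have hregI : Pc (nb x t₁) = fcc3Int ∨ Pc x = hcpInt ∨
        (-zlab Pc nb (nb x t₁) x ∈ Pc (nb x t₁) ∧ -zlab Pc nb (nb x t₁) (nb x t₂) ∈ Pc (nb x t₁)) := by
      refine Or.inr (Or.inr ⟨hI.2.1 (mem_hexLabels_iff.2 (Or.inl rfl)), ?_⟩)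
      have h6 := hI.2.1 (mem_hexLabels_iff.2 (Or.inr (Or.inr (Or.inr (Or.inr (Or.inr rfl))))))
      have e : (Istep Pc nb ⟨x, t₁, t₂, U⟩).t₁ - (Istep Pc nb ⟨x, t₁, t₂, U⟩).t₂ =
          -zlab Pc nb (nb x t₁) (nb x t₂) := by
        show -zlab Pc nb (nb x t₁) x - (zlab Pc nb (nb x t₁) (nb x t₂) - zlab Pc nb (nb x t₁) x) = _
        abel
      rwa [e] at h6
    have hregJ : Pc (nb x t₂) = fcc3Int ∨ Pc x = hcpInt ∨
        (-zlab Pc nb (nb x t₂) x ∈ Pc (nb x t₂) ∧ -zlab Pc nb (nb x t₂) (nb x t₁) ∈ Pc (nb x t₂)) := by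
      refine Or.inr (Or.inr ⟨hJ.2.1 (mem_hexLabels_iff.2 (Or.inr (Or.inl rfl))), ?_⟩)
      have h3 := hJ.2.1 (mem_hexLabels_iff.2 (Or.inr (Or.inr (Or.inl rfl))))
      have e : (Jstep Pc nb ⟨x, t₁, t₂, U⟩).t₂ - (Jstep Pc nb ⟨x, t₁, t₂, U⟩).t₁ =
          -zlab Pc nb (nb x t₂) (nb x t₁) := by
        show -zlab Pc nb (nb x t₂) x - (zlab Pc nb (nb x t₂) (nb x t₁) - zlab Pc nb (nb x t₂) x) = _
        abel
      rwa [e] at h3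
    obtain ⟨hyS, -, -, -, -, -, -, -, -, -, -, -, -, c₁, hc₁U, -, hfiltI, hbu₁, hμU₁, -, -⟩ :=
      Istep_spec hch hx hU hregI
    obtain ⟨hy'S, -, -, -, -, -, -, -, -, -, -, -, -, c₂, hc₂U, -, hfiltJ, hbu₂, hμU₂, -, -⟩ :=
      Jstep_spec hch hx hU hregJ
    have hfx := filter_evenCap (Pc x) hPx t₁ ht₁ t₂ ht₂ c hcP h12 hhex hc hc1 hc2
    have hc₁ : c₁ = c := by
      have h1 := hfx.1
      rw [← hE, hfiltI] at h1
      exact Finset.singleton_injective h1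
    have hc₂ : c₂ = c := by
      have h1 := hfx.2.1
      rw [← hE, hfiltJ] at h1
      exact Finset.singleton_injective h1
    rw [hc₁] at hbu₁ hμU₁
    rw [hc₂] at hbu₂ hμU₂
    have hμ₁ := zlab_spec hch hyS hu.1 hbu₁
    have hμ₂ := zlab_spec hch hy'S hu.1 hbu₂
    have hos1 := onesided_at_apex hch hx hyS hU hI hcU hμU₁ hμ₁.2.symm
    have hos2 := onesided_at_apex hch hx hy'S hU hJ hcU hμU₂ hμ₂.2.symm
    have hos : (-ξ ∈ Pc (nb x c) ∧ -η ∈ Pc (nb x c) ∧ -ζ ∈ Pc (nb x c)) ∨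
        (-ξ ∉ Pc (nb x c) ∧ -η ∉ Pc (nb x c) ∧ -ζ ∉ Pc (nb x c)) := by
      rcases hos1 with ⟨a1, a2⟩ | ⟨a1, a2⟩ <;> rcases hos2 with ⟨b1, b2⟩ | ⟨b1, b2⟩
      · exact Or.inl ⟨a1, a2, b2⟩
      · exact (b1 a1).elim
      · exact (a1 b1).elim
      · exact Or.inr ⟨a1, a2, b2⟩
    obtain ⟨hframeU, hL, hlp⟩ := isFrame_capOpp_even (Pc (nb x c)) hPu ξ hξ.1 η hη.1 ζ hζ.1
      (by rw [sqNormInt_sub_comm]; exact Dηξ) (by rw [sqNormInt_sub_comm]; exact Dζξ) Dηζ hos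
    -- the computation of `Vstep`
    have hV : Vstep Pc nb ⟨x, t₁, t₂, U⟩ =
        ⟨nb x c, η - ξ, ζ - ξ, capOpp (Pc (nb x c)) (η - ξ) (ζ - ξ) ξ⟩ := by
      simp only [Vstep, hapex, if_pos hpar]
      try rfl
    rw [hV]
    refine ⟨hcU, hu.1, hu.2, hξ.1, hξ.2, hframeU, ?_, Or.inl ⟨hpar, ?_, ?_, ?_, hE⟩⟩
    · show lowerParity (η - ξ) (ζ - ξ) (lowerCap (Pc (nb x c)) (η - ξ) (ζ - ξ)
        (capOpp (Pc (nb x c)) (η - ξ) (ζ - ξ) ξ)) = frameParity t₁ t₂ U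
      rw [hL, hpar]; exact hlp
    · show lowerCap (Pc (nb x c)) (η - ξ) (ζ - ξ) (capOpp (Pc (nb x c)) (η - ξ) (ζ - ξ) ξ) =
        {ξ, ξ + (η - ξ), ξ + (ζ - ξ)}
      rw [hL, show ξ + (η - ξ) = η by abel, show ξ + (ζ - ξ) = ζ by abel]
    · show nb (nb x c) (ξ + (η - ξ)) = nb x t₁
      rw [show ξ + (η - ξ) = η by abel]; exact hη.2
    · show nb (nb x c) (ξ + (ζ - ξ)) = nb x t₂
      rw [show ξ + (ζ - ξ) = ζ by abel]; exact hζ.2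
  · /- ODD: lower sites of `u` are `x, I⁻¹x, J⁻¹x` -/
    have hc1 : c + t₁ ∈ Pc x := hUP (by rw [hO]; simp)
    have hc2 : c + t₂ ∈ Pc x := hUP (by rw [hO]; simp)
    have hdx := dist_oddCap (Pc x) hPx t₁ ht₁ t₂ ht₂ c hcP h12 hhex hc hc1 hc2
    have hpar : frameParity t₁ t₂ U = -1 := by
      rw [hO]; exact (isFrame_oddCap (Pc x) hPx t₁ ht₁ t₂ ht₂ c hcP h12 hhex hc hc1 hc2).2
    have hne : ¬ frameParity t₁ t₂ U = 1 := by rw [hpar]; norm_num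
    -- `I⁻¹x, J⁻¹x` are neighbours of `u`
    have hbI : B (nb x c) (nb x (-t₁)) :=
      (bond_nb_iff hch hx hcP hnt₁).2 (by rw [sqNormInt_sub_comm]; exact hdx.1)
    have hbJ : B (nb x c) (nb x (-t₂)) :=
      (bond_nb_iff hch hx hcP hnt₂).2 (by rw [sqNormInt_sub_comm]; exact hdx.2.1)
    have hη := zlab_spec hch hu.1 (nb_mem hch hx hnt₁).1 hbI
    have hζ := zlab_spec hch hu.1 (nb_mem hch hx hnt₂).1 hbJ
    set η := zlab Pc nb (nb x c) (nb x (-t₁)) with hη_def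
    set ζ := zlab Pc nb (nb x c) (nb x (-t₂)) with hζ_def
    have Dηξ : sqNormInt (η - ξ) = 18 := by
      rw [hη_def, hξ_def, transfer_nb_centre hch hx hu.1 hu.2 hnt₁ hbI, sqNormInt_neg]
      exact chart_sqNormInt_eq hch hx ht₁
    have Dζξ : sqNormInt (ζ - ξ) = 18 := by
      rw [hζ_def, hξ_def, transfer_nb_centre hch hx hu.1 hu.2 hnt₂ hbJ, sqNormInt_neg]
      exact chart_sqNormInt_eq hch hx ht₂
    have Dηζ : sqNormInt (η - ζ) = 18 := by
      rw [hη_def, hζ_def, transfer_nb_nb hch hx hu.1 hu.2 hnt₁ hnt₂ hbI hbJ,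
        show -t₁ - -t₂ = t₂ - t₁ by abel, sqNormInt_sub_comm]
      exact h12
    have hregI : Pc (nb x (-t₁)) = fcc3Int ∨ Pc x = hcpInt ∨
        (-zlab Pc nb (nb x (-t₁)) x ∈ Pc (nb x (-t₁)) ∧
          -zlab Pc nb (nb x (-t₁)) (nb x (t₂ - t₁)) ∈ Pc (nb x (-t₁))) :=
      Or.inr (Or.inr ⟨hIi.2.1 (mem_hexLabels_iff.2 (Or.inr (Or.inr (Or.inr (Or.inl rfl))))),
        hIi.2.1 (mem_hexLabels_iff.2 (Or.inr (Or.inr (Or.inr (Or.inr (Or.inl rfl))))))⟩)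
    have hregJ : Pc (nb x (-t₂)) = fcc3Int ∨ Pc x = hcpInt ∨
        (-zlab Pc nb (nb x (-t₂)) x ∈ Pc (nb x (-t₂)) ∧
          -zlab Pc nb (nb x (-t₂)) (nb x (t₁ - t₂)) ∈ Pc (nb x (-t₂))) :=
      Or.inr (Or.inr ⟨hJi.2.1 (mem_hexLabels_iff.2 (Or.inr (Or.inr (Or.inr (Or.inr (Or.inl rfl)))))),
        hJi.2.1 (mem_hexLabels_iff.2 (Or.inr (Or.inr (Or.inr (Or.inl rfl)))))⟩)
    obtain ⟨hyS, -, -, -, -, -, -, -, -, -, -, -, -, c₁, hc₁U, -, hfiltI, hbu₁, hμU₁, -, -⟩ :=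
      IinvStep_spec hch hx hU hregI
    obtain ⟨hy'S, -, -, -, -, -, -, -, -, -, -, -, -, c₂, hc₂U, -, hfiltJ, hbu₂, hμU₂, -, -⟩ :=
      JinvStep_spec hch hx hU hregJ
    have hfx := filter_oddCap (Pc x) hPx t₁ ht₁ t₂ ht₂ c hcP h12 hhex hc hc1 hc2
    have hc₁ : c₁ = c := by
      have h1 := hfx.2.2.1
      rw [← hO, hfiltI] at h1
      exact Finset.singleton_injective h1
    have hc₂ : c₂ = c := by
      have h1 := hfx.2.2.2
      rw [← hO, hfiltJ] at h1
      exact Finset.singleton_injective h1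
    rw [hc₁] at hbu₁ hμU₁
    rw [hc₂] at hbu₂ hμU₂
    have hμ₁ := zlab_spec hch hyS hu.1 hbu₁
    have hμ₂ := zlab_spec hch hy'S hu.1 hbu₂
    have hos1 := onesided_at_apex hch hx hyS hU hIi hcU hμU₁ hμ₁.2.symm
    have hos2 := onesided_at_apex hch hx hy'S hU hJi hcU hμU₂ hμ₂.2.symm
    have hos : (-ξ ∈ Pc (nb x c) ∧ -η ∈ Pc (nb x c) ∧ -ζ ∈ Pc (nb x c)) ∨
        (-ξ ∉ Pc (nb x c) ∧ -η ∉ Pc (nb x c) ∧ -ζ ∉ Pc (nb x c)) := by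
      rcases hos1 with ⟨a1, a2⟩ | ⟨a1, a2⟩ <;> rcases hos2 with ⟨b1, b2⟩ | ⟨b1, b2⟩
      · exact Or.inl ⟨a1, a2, b2⟩
      · exact (b1 a1).elim
      · exact (a1 b1).elim
      · exact Or.inr ⟨a1, a2, b2⟩
    obtain ⟨hframeU, hL, hlp⟩ := isFrame_capOpp_odd (Pc (nb x c)) hPu ξ hξ.1 η hη.1 ζ hζ.1
      (by rw [sqNormInt_sub_comm]; exact Dηξ) (by rw [sqNormInt_sub_comm]; exact Dζξ) Dηζ hos
    have hV : Vstep Pc nb ⟨x, t₁, t₂, U⟩ =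
        ⟨nb x c, ξ - η, ξ - ζ, capOpp (Pc (nb x c)) (ξ - η) (ξ - ζ) ξ⟩ := by
      simp only [Vstep, hapex, if_neg hne]
      try rfl
    rw [hV]
    refine ⟨hcU, hu.1, hu.2, hξ.1, hξ.2, hframeU, ?_, Or.inr ⟨hpar, ?_, ?_, ?_, hO⟩⟩
    · show lowerParity (ξ - η) (ξ - ζ) (lowerCap (Pc (nb x c)) (ξ - η) (ξ - ζ)
        (capOpp (Pc (nb x c)) (ξ - η) (ξ - ζ) ξ)) = frameParity t₁ t₂ U
      rw [hL, hpar]; exact hlp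
    · show lowerCap (Pc (nb x c)) (ξ - η) (ξ - ζ) (capOpp (Pc (nb x c)) (ξ - η) (ξ - ζ) ξ) =
        {ξ, ξ - (ξ - η), ξ - (ξ - ζ)}
      rw [hL, sub_sub_cancel, sub_sub_cancel]
    · show nb (nb x c) (ξ - (ξ - η)) = nb x (-t₁)
      rw [sub_sub_cancel]; exact hη.2
    · show nb (nb x c) (ξ - (ξ - ζ)) = nb x (-t₂)
      rw [sub_sub_cancel]; exact hζ.2

omit hch in
/-! ## Registered anchor (closed form) -/

omit hch in
/-- **Closed form of `Vstep_spec`** (the registered anchor of this file): the section data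
`S, B, Pc, nb` and the standing hypothesis written out, the frame packaged as a `ZFrame`
and the validity hypotheses of the transported frames as one quantified clause. [folklore] -/
theorem Vstep_spec_graded :
    ∀ {S : ℕ → Set (EuclideanSpace ℝ (Fin 3))} {B : EuclideanSpace ℝ (Fin 3) → EuclideanSpace ℝ
    (Fin 3) → Prop} {Pc : EuclideanSpace ℝ (Fin 3) → Finset (Fin 3 → ℤ)} {nb : EuclideanSpace ℝ
    (Fin 3) → (Fin 3 → ℤ) → EuclideanSpace ℝ (Fin 3)}, ((∀ n : ℕ, ∀ z ∈ S n, (Pc z =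
    Summit.AtomisticToContinuum.Crystallization.Theorems.PalmUnimodularRigidityShellsToBarlowChart.fcc3Int
    ∨ Pc z = Literature.Geometry.DiscreteGeometry.hcpInt) ∧ Set.BijOn (nb z) (↑(Pc z) : Set (Fin
    3 → ℤ)) {y | B z y} ∧ ∀ t ∈ Pc z, ∀ t' ∈ Pc z, (B (nb z t) (nb z t') ↔
    Literature.Geometry.DiscreteGeometry.sqNormInt (t - t') = 18)) ∧ (∀ n : ℕ, ∀ z ∈ S (n + 1),
    ∀ y, B z y → y ∈ S n) ∧ (∀ n m : ℕ, ∀ x ∈ S n, ∀ y ∈ S m, B x y → ∀ (z z' : EuclideanSpace ℝ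
    (Fin 3)) (t t' u u' : Fin 3 → ℤ), (t = 0 ∧ z = x ∨ t ∈ Pc x ∧ z = nb x t) → (t' = 0 ∧ z' = x
    ∨ t' ∈ Pc x ∧ z' = nb x t') → (u = 0 ∧ z = y ∨ u ∈ Pc y ∧ z = nb y u) → (u' = 0 ∧ z' = y ∨
    u' ∈ Pc y ∧ z' = nb y u') → Literature.Geometry.DiscreteGeometry.sqNormInt (u - u') =
    Literature.Geometry.DiscreteGeometry.sqNormInt (t - t')) ∧ (∀ x y, B x y → B y x)) → ∀ (n :
    ℕ) (f :
    Summit.AtomisticToContinuum.Crystallization.Theorems.PalmUnimodularRigidityShellsToBarlowChart.ZFrame),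
    f.pt ∈ S (n + 3) → (∀ g :
    Summit.AtomisticToContinuum.Crystallization.Theorems.PalmUnimodularRigidityShellsToBarlowChart.ZFrame,
    g = f ∨ g =
    Summit.AtomisticToContinuum.Crystallization.Theorems.PalmUnimodularRigidityShellsToBarlowChart.Istep
    Pc nb f ∨ g =
    Summit.AtomisticToContinuum.Crystallization.Theorems.PalmUnimodularRigidityShellsToBarlowChart.Jstep
    Pc nb f ∨ g =
    Summit.AtomisticToContinuum.Crystallization.Theorems.PalmUnimodularRigidityShellsToBarlowChart.IinvStep
    Pc nb f ∨ g =
    Summit.AtomisticToContinuum.Crystallization.Theorems.PalmUnimodularRigidityShellsToBarlowChart.JinvStep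
    Pc nb f →
    Summit.AtomisticToContinuum.Crystallization.Theorems.PalmUnimodularRigidityShellsToBarlowChart.IsFrame
    (Pc g.pt) g.t₁ g.t₂ g.U) → nb f.pt
    (Summit.AtomisticToContinuum.Crystallization.Theorems.PalmUnimodularRigidityShellsToBarlowChart.apexOf
    f.t₁ f.t₂ f.U) ∈ S (n + 2) ∧ (B f.pt (nb f.pt
    (Summit.AtomisticToContinuum.Crystallization.Theorems.PalmUnimodularRigidityShellsToBarlowChart.apexOf
    f.t₁ f.t₂ f.U))) := by
  intro S B Pc nb hch n f hx hval 
  obtain ⟨x, t₁, t₂, U⟩ := f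
  have h := Vstep_spec hch hx (hval _ (Or.inl rfl)) (hval _ (Or.inr (Or.inl rfl))) (hval _ (Or.inr (Or.inr (Or.inl rfl)))) (hval _ (Or.inr (Or.inr (Or.inr (Or.inl rfl))))) (hval _ (Or.inr (Or.inr (Or.inr (Or.inr (rfl))))))
  exact ⟨h.2.1, h.2.2.1⟩

end Summit.AtomisticToContinuum.Crystallization.Theorems.SquareWellLayerCakeGapTwelveToBarlow

end
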